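import Summits.KontsevichZagierPeriods.KontsevichZagierPeriods.Theorems.PlanarAreas.Negative.Core
import Summits.KontsevichZagierPeriods.KontsevichZagierPeriods.Theorems.RealOnePeriodRelations.Negative.Kit
import Literature.NumberTheory.Transcendental.SemialgebraicMapsProofs

/-!
# `PlanarAreas` (stmt-KontsevichZagierPeriods-4990): negative side — VIII. divisibility modulo rule 1b, no reduced invariants, the torsion reading

Negative-side support for the crux `PlanarAreas` (cdisprove cycle 2; running commentary in the work
file `Cruxes/PlanarAreas/Disproof.lean` §6).  Three structural facts about the formal group
`KZ.FormalRep ⧸ KZ.relations` that bound the SHAPE of any refutation: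

* §6a **every representation is infinitely divisible modulo rule 1b alone**
  (`of_sub_nsmul_mem_closure_integrandAdd`: `[σ, f] ≡ k • [σ, f/k]`, by `k − 1` instances of
  integrand additivity), hence so is every formal combination
  (`exists_sub_nsmul_mem_closure_integrandAdd`): the quotient by the moves is a DIVISIBLE group
  (and since rule 1b is itself derivable from rules 1a + 3 —
  `StuffleInKZ.Negative.Derived.integrandAddRel_subset_closure_domAdd_nl`, Theorems/StuffleInKZ —
  the same divisibility holds modulo `closure (domainAddRel ∪ newtonLeibnizRel)`; only the
  set-chain group of rules 1a + 2 escapes it);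
* §6b consequently **no additive invariant with values in a reduced group** — `ℤ` (the o-minimal
  Euler characteristic), `ℤⁿ` / lattices (Dehn- or Hadwiger-type bookkeeping of boundary data with
  integer multiplicities), finite groups (parities) — is compatible with rule 1b unless it vanishes
  IDENTICALLY (`apply_of_eq_zero_of_isReducedGroup`, `eq_zero_of_isReducedGroup`); the template
  `not_of_separating_invariant` (Negative/Core) can only ever be fed with divisible-target
  invariants (`ℚ`-vector spaces, `ℝ`, `ℝ/ℤ`, …).  This is a second, independent death of the Euler
  characteristic (cycle 1 killed it through the null overlaps of rule 1a) and it applies verbatim to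
  the summit and to every crux whose conclusion subgroup contains `integrandAddRel`; it does NOT
  apply to the set-chain group of `PlanarK0Injective` (rules 1a + 2 on integrand-`1` regions, no
  1b), where lattice-valued "curved Dehn invariants" remain conceivable — the one formal difference
  between crux 3 and crux 5 of route SymplecticScissors;
* §6c **the torsion reading** of D-0015 (2) ("no division by integers is a rule"): since the
  quotient is divisible, it is torsion-free iff it is a `ℚ`-vector space; the kernel conjecture
  forces torsion-freeness (`saturated_of_kzKernelConjecture`), and so does the crux on planar
  integrand-`1` differences (`sub_mem_relations_of_nsmul_mem`).  Hence a TORSION WITNESS — an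
  equal-area pair connected "`k` times over" (`k • ([r] − [r']) ∈ relations`) but not once — refutes
  the crux (`not_planarAreas_of_torsion`): an attack surface invisible to every `ℝ`-valued
  invariant.  No candidate is known: the natural "doubled" chains (degree-2 semialgebraic
  area-preserving covers, e.g. `w = z²/(√2·|z|)` between annuli) split along a null arc by rule 1a
  into two injective rule-2 moves and halve honestly.

Everything is sorry-free; axioms ⊆ {propext, Classical.choice, Quot.sound}.

Sources: M. Kontsevich, D. Zagier, *Periods* (2001), §1.2 (rule 1); L. Fuchs, *Infinite Abelian
Groups* I (1970), §§20–23 (divisible and reduced groups) — folklore level only. -/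

noncomputable section

open Set MeasureTheory MvPolynomial Filter Topology
open Literature.NumberTheory.Transcendental Literature.ModelTheory.ExponentialFields

namespace Summit.KontsevichZagierPeriods.PlanarAreas.Negative

open Summit.KontsevichZagierPeriods.KontsevichZagierPeriods.Theses.SymplecticScissors (PlanarAreas)

/-! ## §6a Scaling the integrand by a rational; divisibility modulo rule 1b -/

/-- `[σ, q • f]`: the representation with the same domain and the integrand scaled by a rational
`q` (still `ℚ`-semialgebraic and absolutely integrable). [folklore] -/
def scaleRep {n : ℕ} (q : ℚ) (r : KZ.IntegralRep n) : KZ.IntegralRep n where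
  domain := r.domain
  integrand := fun x => (q : ℝ) * r.integrand x
  isSemialgebraic_domain := r.isSemialgebraic_domain
  isSemialgebraicFunOn_integrand :=
    IsSemialgebraicFunOn.mul_holds
      (Summit.KontsevichZagierPeriods.SymplecticScissors.RealOnePeriodRelationsNegative.isSemialgebraicFunOn_ratConst
        r.isSemialgebraic_domain q)
      r.isSemialgebraicFunOn_integrand
  integrableOn := r.integrableOn.const_mul _

/-- The domain of `scaleRep q r` is that of `r`. [folklore] -/
@[simp] theorem scaleRep_domain {n : ℕ} (q : ℚ) (r : KZ.IntegralRep n) :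
    (scaleRep q r).domain = r.domain := rfl

/-- The integrand of `scaleRep q r` is `q • r.integrand`. [folklore] -/
@[simp] theorem scaleRep_integrand {n : ℕ} (q : ℚ) (r : KZ.IntegralRep n) :
    (scaleRep q r).integrand = fun x => (q : ℝ) * r.integrand x := rfl

/-- `value [σ, q • f] = q • value [σ, f]`. [folklore] -/
theorem value_scaleRep {n : ℕ} (q : ℚ) (r : KZ.IntegralRep n) :
    (scaleRep q r).value = q * r.value := by
  simp [KZ.IntegralRep.value, integral_const_mul]

/-- Rule 1b: `[σ, (p + q) f] − [σ, p f] − [σ, q f] ∈ integrandAddRel`. [cite: KontsevichZagier2001, §1.2 rule (1)] -/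
theorem of_scaleRep_add_sub_mem_integrandAddRel {n : ℕ} (p q : ℚ) (r : KZ.IntegralRep n) :
    KZ.of (scaleRep (p + q) r) - KZ.of (scaleRep p r) - KZ.of (scaleRep q r) ∈
      KZ.integrandAddRel := by
  refine ⟨n, scaleRep (p + q) r, scaleRep p r, scaleRep q r, rfl, rfl, ?_, rfl⟩
  intro x _
  simp only [scaleRep_integrand, Pi.add_apply, Rat.cast_add]
  ring

/-- Rule 1b: `[r] − [σ, 1 • f] − [σ, 0 • f] ∈ integrandAddRel`. [cite: KontsevichZagier2001, §1.2 rule (1)] -/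
theorem of_sub_scaleRep_one_sub_scaleRep_zero_mem {n : ℕ} (r : KZ.IntegralRep n) :
    KZ.of r - KZ.of (scaleRep 1 r) - KZ.of (scaleRep 0 r) ∈ KZ.integrandAddRel := by
  refine ⟨n, r, scaleRep 1 r, scaleRep 0 r, rfl, rfl, ?_, rfl⟩
  intro x _
  simp

/-- The zero-integrand representation `[σ, 0]` lies in the 1b-closure (`[s] − [s] − [s] ∈ 1b` for
`s = [σ, 0 • f]`, as `0 = 0 + 0`). [folklore] -/
theorem of_scaleRep_zero_mem_closure {n : ℕ} (r : KZ.IntegralRep n) :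
    KZ.of (scaleRep 0 r) ∈ AddSubgroup.closure KZ.integrandAddRel := by
  have h : KZ.of (scaleRep 0 r) - KZ.of (scaleRep 0 r) - KZ.of (scaleRep 0 r) ∈
      KZ.integrandAddRel := by
    refine ⟨n, scaleRep 0 r, scaleRep 0 r, scaleRep 0 r, rfl, rfl, ?_, rfl⟩
    intro x _
    simp
  have heq : KZ.of (scaleRep 0 r) - KZ.of (scaleRep 0 r) - KZ.of (scaleRep 0 r) =
      -KZ.of (scaleRep 0 r) := by abel
  have h' : -KZ.of (scaleRep 0 r) ∈ AddSubgroup.closure KZ.integrandAddRel := by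
    rw [← heq]
    exact AddSubgroup.subset_closure h
  simpa using AddSubgroup.neg_mem _ h'

/-- `[σ, (m/k) f] ≡ m • [σ, (1/k) f]` modulo rule 1b. [folklore] -/
theorem of_scaleRep_div_sub_nsmul_mem {n : ℕ} (r : KZ.IntegralRep n) (k m : ℕ) :
    KZ.of (scaleRep ((m : ℚ) / k) r) - m • KZ.of (scaleRep ((1 : ℚ) / k) r) ∈
      AddSubgroup.closure KZ.integrandAddRel := by
  induction m with
  | zero => simpa using of_scaleRep_zero_mem_closure r
  | succ m ih =>
    have hstep := AddSubgroup.subset_closure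
      (of_scaleRep_add_sub_mem_integrandAddRel ((m : ℚ) / k) ((1 : ℚ) / k) r)
    have heq : (m : ℚ) / k + 1 / k = ((m + 1 : ℕ) : ℚ) / k := by
      push_cast
      ring
    rw [heq] at hstep
    have := AddSubgroup.add_mem _ hstep ih
    convert this using 1
    rw [succ_nsmul]
    abel

/-- **Every representation is infinitely divisible modulo rule 1b**:
`[σ, f] − k • [σ, f/k] ∈ closure integrandAddRel` for every `k ≥ 1`. [folklore] -/
theorem of_sub_nsmul_mem_closure_integrandAdd {n : ℕ} (r : KZ.IntegralRep n) {k : ℕ}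
    (hk : 0 < k) :
    KZ.of r - k • KZ.of (scaleRep ((1 : ℚ) / k) r) ∈ AddSubgroup.closure KZ.integrandAddRel := by
  have h1 := of_scaleRep_div_sub_nsmul_mem r k k
  have hkk : ((k : ℚ) / k) = 1 := div_self (by exact_mod_cast hk.ne')
  rw [hkk] at h1
  have h2 : KZ.of r - KZ.of (scaleRep 1 r) - KZ.of (scaleRep 0 r) ∈
      AddSubgroup.closure KZ.integrandAddRel :=
    AddSubgroup.subset_closure (of_sub_scaleRep_one_sub_scaleRep_zero_mem r)
  have h3 := of_scaleRep_zero_mem_closure r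
  have := AddSubgroup.add_mem _ (AddSubgroup.add_mem _ h2 h3) h1
  convert this using 1
  abel

/-- **The quotient by the moves is a divisible group**: every formal combination is `k`-divisible
modulo rule 1b, for every `k ≥ 1`. [folklore] -/
theorem exists_sub_nsmul_mem_closure_integrandAdd (c : KZ.FormalRep) {k : ℕ} (hk : 0 < k) :
    ∃ d : KZ.FormalRep, c - k • d ∈ AddSubgroup.closure KZ.integrandAddRel := by
  induction c using FreeAbelianGroup.induction_on with
  | zero => exact ⟨0, by simp⟩
  | of x =>
    obtain ⟨n, r⟩ := x
    exact ⟨KZ.of (scaleRep ((1 : ℚ) / k) r), of_sub_nsmul_mem_closure_integrandAdd r hk⟩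
  | neg x hx =>
    obtain ⟨d, hd⟩ := hx
    refine ⟨-d, ?_⟩
    have := AddSubgroup.neg_mem _ hd
    convert this using 1
    rw [neg_nsmul]
    abel
  | add x y hx hy =>
    obtain ⟨d, hd⟩ := hx
    obtain ⟨d', hd'⟩ := hy
    refine ⟨d + d', ?_⟩
    have := AddSubgroup.add_mem _ hd hd'
    convert this using 1
    rw [nsmul_add]
    abel

/-- The same divisibility modulo the full subgroup of relations. [folklore] -/
theorem exists_sub_nsmul_mem_relations (c : KZ.FormalRep) {k : ℕ} (hk : 0 < k) :
    ∃ d : KZ.FormalRep, c - k • d ∈ KZ.relations := by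
  obtain ⟨d, hd⟩ := exists_sub_nsmul_mem_closure_integrandAdd c hk
  exact ⟨d, (AddSubgroup.closure_mono fun x hx => Or.inl (Or.inl (Or.inr hx))) hd⟩

/-! ## §6b No reduced-group-valued invariants -/

/-- An additive group is *reduced* (elementwise form used here): its only infinitely divisible
element is `0`. [folklore] -/
def IsReducedGroup (A : Type*) [AddCommGroup A] : Prop :=
  ∀ a : A, (∀ k : ℕ, 0 < k → ∃ b : A, a = k • b) → a = 0

/-- `ℤ` is reduced. [folklore] -/
theorem isReducedGroup_int : IsReducedGroup ℤ := by
  intro a ha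
  by_contra hne
  obtain ⟨b, hb⟩ := ha (a.natAbs + 1) (Nat.succ_pos _)
  have hb0 : b ≠ 0 := by
    rintro rfl
    simp at hb
    exact hne hb
  have h1 : a.natAbs = (a.natAbs + 1) * b.natAbs := by
    have := congrArg Int.natAbs hb
    rw [nsmul_eq_mul, Int.natAbs_mul, Int.natAbs_natCast] at this
    exact this
  have h2 : 0 < b.natAbs := Int.natAbs_pos.mpr hb0
  have h3 : a.natAbs + 1 ≤ (a.natAbs + 1) * b.natAbs := Nat.le_mul_of_pos_right _ h2
  omega

/-- Finite additive groups are reduced (`|A| • b = 0`). [folklore] -/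
theorem isReducedGroup_of_finite (A : Type*) [AddCommGroup A] [Finite A] : IsReducedGroup A := by
  intro a ha
  haveI := Fintype.ofFinite A
  obtain ⟨b, hb⟩ := ha (Fintype.card A) Fintype.card_pos
  rw [hb, card_nsmul_eq_zero]

/-- Products of reduced groups (e.g. lattices `ι → ℤ`) are reduced. [folklore] -/
theorem isReducedGroup_pi {ι : Type*} {A : ι → Type*} [∀ i, AddCommGroup (A i)]
    (h : ∀ i, IsReducedGroup (A i)) : IsReducedGroup (∀ i, A i) := by
  intro a ha
  funext i
  refine h i (a i) fun k hk => ?_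
  obtain ⟨b, hb⟩ := ha k hk
  exact ⟨b i, by rw [hb]; rfl⟩

/-- **Rule 1b kills every reduced-group-valued invariant on generators.**  If `J : FormalRep →+ A`
vanishes on the integrand-additivity move set and `A` is reduced, then `J [r] = 0` for EVERY
representation `r` (its value is infinitely divisible by §6a). [folklore] -/
theorem apply_of_eq_zero_of_isReducedGroup {A : Type*} [AddCommGroup A] (hA : IsReducedGroup A)
    (J : KZ.FormalRep →+ A) (hJ : ∀ x ∈ KZ.integrandAddRel, J x = 0) {n : ℕ}
    (r : KZ.IntegralRep n) : J (KZ.of r) = 0 := by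
  have hker : AddSubgroup.closure KZ.integrandAddRel ≤ J.ker := (AddSubgroup.closure_le _).mpr hJ
  refine hA _ fun k hk => ⟨J (KZ.of (scaleRep ((1 : ℚ) / k) r)), ?_⟩
  have := hker (of_sub_nsmul_mem_closure_integrandAdd r hk)
  rwa [AddMonoidHom.mem_ker, map_sub, map_nsmul, sub_eq_zero] at this

/-- … hence `J = 0` on the whole formal group. [folklore] -/
theorem eq_zero_of_isReducedGroup {A : Type*} [AddCommGroup A] (hA : IsReducedGroup A)
    (J : KZ.FormalRep →+ A) (hJ : ∀ x ∈ KZ.integrandAddRel, J x = 0) : J = 0 := by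
  refine AddMonoidHom.ext fun c => ?_
  induction c using FreeAbelianGroup.induction_on with
  | zero => simp
  | of x =>
    obtain ⟨n, r⟩ := x
    exact apply_of_eq_zero_of_isReducedGroup hA J hJ r
  | neg x hx => rw [map_neg, hx]; simp
  | add x y hx hy => rw [map_add, hx, hy]; simp

/-- **No Euler-characteristic / lattice / parity refutation of the crux**: a reduced-group-valued
invariant compatible with rule 1b separates NO two representations, so it can never instantiate
`not_of_separating_invariant`.  Refuting invariants must take values in groups with infinitely
divisible elements. [folklore] -/
theorem not_separating_of_isReducedGroup {A : Type*} [AddCommGroup A] (hA : IsReducedGroup A)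
    (J : KZ.FormalRep →+ A) (hJ : ∀ x ∈ KZ.integrandAddRel, J x = 0) {n m : ℕ}
    (r : KZ.IntegralRep n) (r' : KZ.IntegralRep m) : J (KZ.of r) = J (KZ.of r') := by
  rw [apply_of_eq_zero_of_isReducedGroup hA J hJ r, apply_of_eq_zero_of_isReducedGroup hA J hJ r']

/-! ## §6c The torsion reading -/

/-- `relations` is SATURATED in `FormalRep` (the quotient is torsion-free): `k • c ∈ relations`
with `k ≥ 1` forces `c ∈ relations`. A refuter-posited reading of D-0015 (2), not a printed
statement. -/
def RelationsSaturated : Prop :=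
  ∀ (c : KZ.FormalRep) (k : ℕ), 0 < k → k • c ∈ KZ.relations → c ∈ KZ.relations

/-- The kernel conjecture (≡ the summit, `kzKernelConjecture_iff_isRational`) implies saturation:
`k • eval c = 0 ⇒ eval c = 0 ⇒ c ∈ relations`. [cite: KontsevichZagier2001, §1.2] -/
theorem saturated_of_kzKernelConjecture (h : KZKernelConjecture) : RelationsSaturated := by
  intro c k hk hmem
  apply h
  have := KZ.relations_le_ker_eval_holds hmem
  rw [AddMonoidHom.mem_ker, map_nsmul, nsmul_eq_mul] at this
  have hk' : (k : ℝ) ≠ 0 := by exact_mod_cast hk.ne'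
  exact (mul_eq_zero.mp this).resolve_left hk'

/-- **The crux saturates planar integrand-`1` differences**: if `k • ([r] − [r'])` is a relation
(`k ≥ 1`) then so is `[r] − [r']` — soundness gives `k • (area r − area r') = 0`, and the crux does
the rest. [cite: KontsevichZagier2001, §1.2] -/
theorem sub_mem_relations_of_nsmul_mem (h : PlanarAreas) (r r' : KZ.IntegralRep 2)
    (hr : ∀ p ∈ r.domain, r.integrand p = 1) (hr' : ∀ p ∈ r'.domain, r'.integrand p = 1)
    {k : ℕ} (hk : 0 < k) (hmem : k • (KZ.of r - KZ.of r') ∈ KZ.relations) :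
    KZ.of r - KZ.of r' ∈ KZ.relations := by
  apply h r r' hr hr'
  have := KZ.relations_le_ker_eval_holds hmem
  rw [AddMonoidHom.mem_ker, map_nsmul, map_sub, KZ.eval_of, KZ.eval_of, nsmul_eq_mul] at this
  have hk' : (k : ℝ) ≠ 0 := by exact_mod_cast hk.ne'
  exact sub_eq_zero.mp ((mul_eq_zero.mp this).resolve_left hk')

/-- **A torsion witness refutes the crux** (and, through `not_summit_of_not`, the summit): an
equal-area integrand-`1` planar pair connected `k` times over but not once.  This is the one attack
surface that no `ℝ`-valued (more generally: no torsion-free-valued) invariant can see; by §6a the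
quotient is divisible, so such torsion is the ONLY way it can fail to be a `ℚ`-vector space.
No candidate pair is known (cycle 2). [cite: KontsevichZagier2001, §1.2] -/
theorem not_planarAreas_of_torsion (r r' : KZ.IntegralRep 2)
    (hr : ∀ p ∈ r.domain, r.integrand p = 1) (hr' : ∀ p ∈ r'.domain, r'.integrand p = 1)
    {k : ℕ} (hk : 0 < k) (hmem : k • (KZ.of r - KZ.of r') ∈ KZ.relations)
    (hnot : KZ.of r - KZ.of r' ∉ KZ.relations) : ¬ PlanarAreas :=
  fun h => hnot (sub_mem_relations_of_nsmul_mem h r r' hr hr' hk hmem)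

/-- Equal areas are automatic for a torsion pair (soundness), so the value hypothesis of the crux
is already met by any `k`-fold relation. [cite: KontsevichZagier2001, §1.2] -/
theorem value_eq_of_nsmul_sub_mem {n m : ℕ} (r : KZ.IntegralRep n) (r' : KZ.IntegralRep m)
    {k : ℕ} (hk : 0 < k) (hmem : k • (KZ.of r - KZ.of r') ∈ KZ.relations) :
    r.value = r'.value := by
  have := KZ.relations_le_ker_eval_holds hmem
  rw [AddMonoidHom.mem_ker, map_nsmul, map_sub, KZ.eval_of, KZ.eval_of, nsmul_eq_mul] at this
  have hk' : (k : ℝ) ≠ 0 := by exact_mod_cast hk.ne'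
  exact sub_eq_zero.mp ((mul_eq_zero.mp this).resolve_left hk')

end Summit.KontsevichZagierPeriods.PlanarAreas.Negative

end
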